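import Summits.QuantumFields.BalabanUV.T4Continuum.Support.NE7InterpolationLiftFlat
import Summits.QuantumFields.BalabanUV.T4Continuum.Support.NE7SmoothRightInverseLevelQ
import Summits.QuantumFields.BalabanUV.T4Continuum.Support.NE3CoarseInterpolant
import Summits.QuantumFields.BalabanUV.T4Continuum.Support.NE3CovariantLineSumGauge
import HarnessLib

/-!
# NE7InterpolationLiftCurl — THE CURL OF THE INTERPOLATION LIFT IS CONTROLLED BY THE COARSE GRADIENT OF THE DATUM:
# `Σ_{p ∈ perWin (M·N)} nhsNormSq (curl_1 (ilift M φ) p) ≤ 2304·4^d·(M^d∕M⁴)·Σ_{z ∈ periodBox N} Σ_μ Σ_ν nhsNormSq (φ(z+e_μ) ν − φ z ν)` — HOMOGENEOUS, scale-correct (`M^{d−4} = 1` at `d = 4`)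

Lineage `b2b-balaban-t4-ne7b-p1` (row NE7b OWNER; junction service for row NE7), generation 160; item (U) of `t4/b2b-balaban-t4-ne7-p1-g116/ROAD-G116.md` §6, homogeneous half, file 2.
The interpolation lift of ✓ `NE7InterpolationLiftFlat` (`ilift M φ (z,κ) = (12M∕((M−1)(M+1)(M+2))·lprof M (res_κ z)) • interp M (univ∖{κ}) (φ(·,κ)) z`, written out; no `def`):
a transverse unit step `α ≠ κ` moves it by `(a·lprof(res_κ z)∕M) • interp M (univ∖{κ,α}) (∇_α φ(·,κ)) z` (✓ `SmoothRefineInterp.interp_add_e_of_mem`), a REAL SCALAR of size `≤ 24∕M²`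
times a multilinear interpolant of the coarse FORWARD DIFFERENCES — so the flat curl of the lift is `O(∇φ∕M²)` on every plaquette, and a CONSTANT datum is lifted to a CURL-FREE field
(contrast ✓ `NE3SmoothLiftCurl`: row NE3's in-block bump lift has curl `O(φ∕M²)`).
WHAT ([folklore]; 0 def, 0 sorry; every `d ≥ 1`, `M ≥ 2`): §1 `twelve_mul_le` (`12M∕((M−1)(M+1)(M+2)) ≤ 24∕M²`), **`interpLift_step_eq_smul`**; `isSkewDir_interpLift`, `interpLift_add_period`;
§2 `nhsNormSq_interpCore_le` (over ✓ `NE3CovariantLineSumCore.nhsNormSq_sum_le_card_mul`) (`nhsNormSq (interpCore S F z w) ≤ 2^{|S|}·Σ_{T⊆S} nhsNormSq (F (z + 𝟙_T))` for weights in `[0,1]`), `nhsNormSq_interpLift_step_le`;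
§3 **`nhsNormSq_curlAt_flat_interpLift_le`** (pointwise), §4 counting (`sum_plane_le_sum_all`, block summation, corner shifts) and **`sum_nhsNormSq_curl_interpLift_le`** (the display).
HONEST FRAMING: flat lattice kinematics of OUR lift; nothing of Bałaban's asserted; NOT NE7∕NE3 as spine nodes; row NE7b NOT touched; spine 0∕9; finite T⁴ rung (B)+1 — NOT infinite
volume, NOT mass gap, NOT BetaPertH, NOT Clay.
-/

set_option autoImplicit false

open scoped BigOperators Matrix Matrix.Norms.L2Operator
open Finset

namespace Summit.QuantumFields.BalabanUV.T4Continuum.NE7InterpolationLiftCurl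

open Literature.MathematicalPhysics.QuantumFieldTheory.Balaban1983to89
open B7Prop1Explicit B7Prop2Explicit
open T4AveragingDeficitWall (curl curlAt IsSkewDir)
open T4AveragingDeficitWallBoundary (periodBox mem_periodBox card_periodBox sum_periodBox_shift)
open MinimalActionLevels (perWin)
open MatrixNorms (nhsNormSq nhsNormSq_nonneg)
open AveragingDeficitHSInner (nhsNormSq_smul)
open SmoothRefineBlocks (blk res res_nonneg res_lt res_add_e_ne blk_res_add_period)
open SmoothRefineInterp (interp interpCore indic cfd wt wt_nonneg wt_le_one interp_mem interp_add_e_of_mem)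
open NE3SmoothLiftProfile (lprof abs_lprof_le)
open NE3SmoothLiftCurl (curlAt_flat_eq)
open NE3CoarseInterpolant (blk_block interp_add_period)
open NE3BlockLineAverage (sum_periodBox_blocks)
open NE7SmoothRightInverseLevelQ (nhsNormSq_sub_le_two sum_perWin_nhsNormSq_curl')
open NE3CovariantLineSumCore (nhsNormSq_sum_le_card_mul)

noncomputable section

variable {d : ℕ} {n : Type} [Fintype n] [DecidableEq n]

/-! ## §1 The transverse step of the interpolation lift -/

/-- `12M∕((M−1)(M+1)(M+2)) ≤ 24∕M²` and `0 ≤ 12M∕((M−1)(M+1)(M+2))` (`M ≥ 2`). [folklore] -/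
theorem twelve_mul_le {M : ℕ} (hM : 2 ≤ M) :
    0 ≤ 12 * (M : ℝ) / ((((M : ℝ)) - 1) * ((M : ℝ) + 1) * ((M : ℝ) + 2)) ∧
      12 * (M : ℝ) / ((((M : ℝ)) - 1) * ((M : ℝ) + 1) * ((M : ℝ) + 2)) ≤ 24 / (M : ℝ) ^ 2 := by
  have hM2 : (2 : ℝ) ≤ M := by exact_mod_cast hM
  have h1 : (0 : ℝ) < ((M : ℝ)) - 1 := by linarith
  have hE : (0 : ℝ) < (((M : ℝ)) - 1) * ((M : ℝ) + 1) * ((M : ℝ) + 2) := by positivity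
  refine ⟨by positivity, ?_⟩
  rw [div_le_div_iff₀ hE (by positivity)]
  -- `12 M · M² ≤ 24 (M−1)(M+1)(M+2)` since `(M−1)(M+1)(M+2) ≥ M³∕2`
  nlinarith [mul_nonneg (mul_nonneg (by linarith : (0 : ℝ) ≤ (M : ℝ) - 2) (by positivity : (0 : ℝ) ≤ (M : ℝ))) (by positivity : (0 : ℝ) ≤ (M : ℝ)),
    mul_nonneg (by linarith : (0 : ℝ) ≤ (M : ℝ) - 2) (by positivity : (0 : ℝ) ≤ (M : ℝ))]

omit [Fintype n] [DecidableEq n] in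
/-- **A TRANSVERSE UNIT STEP MOVES THE INTERPOLATION LIFT BY A SMALL SCALAR MULTIPLE OF AN INTERPOLANT OF THE COARSE GRADIENT** (`M ≥ 2`, `α ≠ κ`):
`ilift M φ (x + e_α) κ − ilift M φ x κ = s • interp M ((univ∖{κ})∖{α}) (∇_α φ(·,κ)) x` with `|s| ≤ 24∕M²`. [folklore] -/
theorem interpLift_step_eq_smul {M : ℕ} (hM : 2 ≤ M) (φ : Site d → Fin d → Matrix n n ℂ) (x : Site d) {α κ : Fin d} (hne : α ≠ κ) :
    ∃ s : ℝ, |s| ≤ 24 / (M : ℝ) ^ 2 ∧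
      (fun z κ' => ((12 * (M : ℝ) / ((((M : ℝ)) - 1) * ((M : ℝ) + 1) * ((M : ℝ) + 2))) * lprof M (res M z κ'))
          • interp M (Finset.univ.erase κ') (fun w => φ w κ') z) (x + e α) κ
        - (fun z κ' => ((12 * (M : ℝ) / ((((M : ℝ)) - 1) * ((M : ℝ) + 1) * ((M : ℝ) + 2))) * lprof M (res M z κ'))
          • interp M (Finset.univ.erase κ') (fun w => φ w κ') z) x κ
        = s • interp M ((Finset.univ.erase κ).erase α) (cfd α (fun w => φ w κ)) x := by
  have hM1 : 1 ≤ M := by omega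
  have hM0 : (0 : ℝ) < M := by exact_mod_cast (by omega : 0 < M)
  obtain ⟨ha0, ha⟩ := twelve_mul_le hM
  set a : ℝ := 12 * (M : ℝ) / ((((M : ℝ)) - 1) * ((M : ℝ) + 1) * ((M : ℝ) + 2)) with hadef
  have hαS : α ∈ Finset.univ.erase κ := Finset.mem_erase.mpr ⟨hne, Finset.mem_univ α⟩
  refine ⟨a * lprof M (res M x κ) * (1 / (M : ℝ)), ?_, ?_⟩
  · have hg : |lprof M (res M x κ)| ≤ M := abs_lprof_le hM1 (res_nonneg hM1 x κ) (res_lt hM1 x κ).le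
    rw [abs_mul, abs_mul, abs_of_nonneg ha0, abs_of_pos (by positivity : (0 : ℝ) < 1 / M)]
    calc a * |lprof M (res M x κ)| * (1 / (M : ℝ)) ≤ a * (M : ℝ) * (1 / M) :=
          mul_le_mul_of_nonneg_right (mul_le_mul_of_nonneg_left hg ha0) (by positivity)
      _ = a := by field_simp
      _ ≤ 24 / (M : ℝ) ^ 2 := ha
  · show (a * lprof M (res M (x + e α) κ)) • interp M (Finset.univ.erase κ) (fun w => φ w κ) (x + e α)
        - (a * lprof M (res M x κ)) • interp M (Finset.univ.erase κ) (fun w => φ w κ) x = _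
    rw [res_add_e_ne hM1 x hne.symm, ← smul_sub, interp_add_e_of_mem hM1 hαS, smul_smul]

omit [Fintype n] [DecidableEq n] in
/-- The interpolation lift of a skew coarse field is skew (real scalar weights, ✓ `interp_mem`). [folklore] -/
theorem isSkewDir_interpLift (M : ℕ) {φ : Site d → Fin d → Matrix n n ℂ} (hφ : IsSkewDir φ) :
    IsSkewDir (fun z κ' => ((12 * (M : ℝ) / ((((M : ℝ)) - 1) * ((M : ℝ) + 1) * ((M : ℝ) + 2))) * lprof M (res M z κ'))
      • interp M (Finset.univ.erase κ') (fun w => φ w κ') z) := fun z κ' =>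
  skewAdjoint.smul_mem _ (interp_mem (skewAdjoint (Matrix n n ℂ)) (fun r _ hX => skewAdjoint.smul_mem r hX) _ _ (fun w => hφ w κ') z)

omit [Fintype n] [DecidableEq n] in
/-- The interpolation lift of an `N`-periodic coarse field is `(M·N)`-periodic (`M ≥ 1`). [folklore] -/
theorem interpLift_add_period {M : ℕ} (hM : 1 ≤ M) {N : ℕ} {φ : Site d → Fin d → Matrix n n ℂ}
    (hφ : ∀ (z : Site d) (τ κ : Fin d), φ (z + (N : ℤ) • e τ) κ = φ z κ) (x : Site d) (τ κ : Fin d) :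
    (fun z κ' => ((12 * (M : ℝ) / ((((M : ℝ)) - 1) * ((M : ℝ) + 1) * ((M : ℝ) + 2))) * lprof M (res M z κ'))
        • interp M (Finset.univ.erase κ') (fun w => φ w κ') z) (x + ((M * N : ℕ) : ℤ) • e τ) κ
      = (fun z κ' => ((12 * (M : ℝ) / ((((M : ℝ)) - 1) * ((M : ℝ) + 1) * ((M : ℝ) + 2))) * lprof M (res M z κ'))
        • interp M (Finset.univ.erase κ') (fun w => φ w κ') z) x κ := by
  have hP : ((M * N : ℕ) : ℤ) = (M : ℤ) * (N : ℤ) := by push_cast; ring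
  have hr : res M (x + ((M * N : ℕ) : ℤ) • e τ) = res M x := by rw [hP]; exact (blk_res_add_period hM x (N : ℤ) τ).2
  show (_ : ℝ) • interp M (Finset.univ.erase κ) (fun w => φ w κ) (x + ((M * N : ℕ) : ℤ) • e τ) = (_ : ℝ) • interp M (Finset.univ.erase κ) (fun w => φ w κ) x
  rw [hr, interp_add_period hM (Finset.univ.erase κ) (fun z τ' => hφ z τ' κ) x τ]

/-! ## §2 The multilinear interpolant in the `nhsNormSq` currency -/

omit [DecidableEq n] in
/-- **THE INTERPOLANT IN THE `nhsNormSq` CURRENCY** (weights in `[0,1]`): `nhsNormSq (interpCore S F z w) ≤ 2^{|S|}·Σ_{T ⊆ S} nhsNormSq (F (z + 𝟙_T))`. [folklore] -/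
theorem nhsNormSq_interpCore_le [Nonempty n] (S : Finset (Fin d)) (F : Site d → Matrix n n ℂ) (z : Site d) {w : Fin d → ℝ}
    (hw0 : ∀ i, 0 ≤ w i) (hw1 : ∀ i, w i ≤ 1) :
    nhsNormSq (interpCore S F z w) ≤ 2 ^ S.card * ∑ T ∈ S.powerset, nhsNormSq (F (z + indic T)) := by
  unfold interpCore
  refine (nhsNormSq_sum_le_card_mul _ _).trans ?_
  rw [Finset.card_powerset, Nat.cast_pow, Nat.cast_two]
  refine mul_le_mul_of_nonneg_left (Finset.sum_le_sum fun T _ => ?_) (by positivity)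
  rw [nhsNormSq_smul]
  have hc0 : 0 ≤ (∏ i ∈ T, w i) * ∏ i ∈ S \ T, (1 - w i) :=
    mul_nonneg (Finset.prod_nonneg fun i _ => hw0 i) (Finset.prod_nonneg fun i _ => sub_nonneg.mpr (hw1 i))
  have hc1 : (∏ i ∈ T, w i) * ∏ i ∈ S \ T, (1 - w i) ≤ 1 :=
    mul_le_one₀ (Finset.prod_le_one (fun i _ => hw0 i) fun i _ => hw1 i) (Finset.prod_nonneg fun i _ => sub_nonneg.mpr (hw1 i))
      (Finset.prod_le_one (fun i _ => sub_nonneg.mpr (hw1 i)) fun i _ => sub_le_self _ (hw0 i))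
  calc ((∏ i ∈ T, w i) * ∏ i ∈ S \ T, (1 - w i)) ^ 2 * nhsNormSq (F (z + indic T)) ≤ 1 * nhsNormSq (F (z + indic T)) :=
        mul_le_mul_of_nonneg_right (by nlinarith) (nhsNormSq_nonneg _)
    _ = _ := one_mul _

omit [DecidableEq n] in
/-- The fine interpolant in the `nhsNormSq` currency: `nhsNormSq (interp M S F x) ≤ 2^{|S|}·Σ_{T ⊆ S} nhsNormSq (F (blk M x + 𝟙_T))` (`M ≥ 1`). [folklore] -/
theorem nhsNormSq_interp_le [Nonempty n] {M : ℕ} (hM : 1 ≤ M) (S : Finset (Fin d)) (F : Site d → Matrix n n ℂ) (x : Site d) :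
    nhsNormSq (interp M S F x) ≤ 2 ^ S.card * ∑ T ∈ S.powerset, nhsNormSq (F (blk M x + indic T)) :=
  nhsNormSq_interpCore_le S F (blk M x) (wt_nonneg hM x) (wt_le_one hM x)

omit [DecidableEq n] in
/-- **`nhsNormSq` STEP LETTER OF THE INTERPOLATION LIFT** (`M ≥ 2`, `α ≠ κ`):
`nhsNormSq (ilift(x + e_α) κ − ilift x κ) ≤ (24∕M²)²·2^d·Σ_{T ⊆ univ} nhsNormSq (φ (blk x + 𝟙_T + e_α) κ − φ (blk x + 𝟙_T) κ)`. [folklore] -/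
theorem nhsNormSq_interpLift_step_le [Nonempty n] {M : ℕ} (hM : 2 ≤ M) (φ : Site d → Fin d → Matrix n n ℂ) (x : Site d) {α κ : Fin d} (hne : α ≠ κ) :
    nhsNormSq ((fun z κ' => ((12 * (M : ℝ) / ((((M : ℝ)) - 1) * ((M : ℝ) + 1) * ((M : ℝ) + 2))) * lprof M (res M z κ'))
          • interp M (Finset.univ.erase κ') (fun w => φ w κ') z) (x + e α) κ
        - (fun z κ' => ((12 * (M : ℝ) / ((((M : ℝ)) - 1) * ((M : ℝ) + 1) * ((M : ℝ) + 2))) * lprof M (res M z κ'))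
          • interp M (Finset.univ.erase κ') (fun w => φ w κ') z) x κ)
      ≤ (24 / (M : ℝ) ^ 2) ^ 2 * (2 ^ d * ∑ T ∈ (Finset.univ : Finset (Fin d)).powerset,
          nhsNormSq (φ (blk M x + indic T + e α) κ - φ (blk M x + indic T) κ)) := by
  have hM1 : 1 ≤ M := by omega
  obtain ⟨s, hs, heq⟩ := interpLift_step_eq_smul hM φ x hne
  rw [heq, nhsNormSq_smul, ← sq_abs]
  refine mul_le_mul (pow_le_pow_left₀ (abs_nonneg s) hs 2) ?_ (nhsNormSq_nonneg _) (by positivity)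
  refine (nhsNormSq_interp_le hM1 _ _ x).trans ?_
  have hcard : ((Finset.univ.erase κ).erase α).card ≤ d := (Finset.card_le_univ _).trans (by rw [Fintype.card_fin])
  refine mul_le_mul (pow_le_pow_right₀ (by norm_num) hcard) ?_ (Finset.sum_nonneg fun T _ => nhsNormSq_nonneg _) (by positivity)
  refine Finset.sum_le_sum_of_subset_of_nonneg (Finset.powerset_mono.mpr (Finset.subset_univ _)) fun T _ _ => nhsNormSq_nonneg _

/-! ## §3 The flat curl of the interpolation lift, plaquette by plaquette -/

/-- **THE FLAT CURL OF THE INTERPOLATION LIFT IS `O(∇φ∕M²)` ON EVERY PLAQUETTE** (`M ≥ 2`, `μ ≠ ν`):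
`nhsNormSq (curlAt 1 (ilift φ) x μ ν) ≤ 2·(24∕M²)²·2^d·(Σ_T nhsNormSq (∇_μ φ(blk x + 𝟙_T, ν)) + Σ_T nhsNormSq (∇_ν φ(blk x + 𝟙_T, μ)))`. [folklore] -/
theorem nhsNormSq_curlAt_flat_interpLift_le [Nonempty n] {M : ℕ} (hM : 2 ≤ M) (φ : Site d → Fin d → Matrix n n ℂ) (x : Site d) {μ ν : Fin d} (hμν : μ ≠ ν) :
    nhsNormSq (curlAt (BlockAveragePushDirSplit.flat (d := d) (n := n))
        (fun z κ' => ((12 * (M : ℝ) / ((((M : ℝ)) - 1) * ((M : ℝ) + 1) * ((M : ℝ) + 2))) * lprof M (res M z κ'))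
          • interp M (Finset.univ.erase κ') (fun w => φ w κ') z) x μ ν)
      ≤ 2 * ((24 / (M : ℝ) ^ 2) ^ 2 * (2 ^ d *
          (∑ T ∈ (Finset.univ : Finset (Fin d)).powerset, nhsNormSq (φ (blk M x + indic T + e μ) ν - φ (blk M x + indic T) ν)
            + ∑ T ∈ (Finset.univ : Finset (Fin d)).powerset, nhsNormSq (φ (blk M x + indic T + e ν) μ - φ (blk M x + indic T) μ)))) := by
  rw [curlAt_flat_eq]
  refine (nhsNormSq_sub_le_two _ _).trans ?_
  have h1 := nhsNormSq_interpLift_step_le hM φ x hμν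
  have h2 := nhsNormSq_interpLift_step_le hM φ x (Ne.symm hμν)
  linarith [h1, h2]

/-! ## §4 Counting: planes, blocks, corner shifts -/

omit [Fintype n] [DecidableEq n] in
/-- `Σ_{π=(μ<ν)} h(μ,ν) ≤ Σ_μ Σ_ν h(μ,ν)` and the same for `h(ν,μ)`, for `h ≥ 0`. [folklore] -/
theorem sum_plane_le_sum_all {h : Fin d → Fin d → ℝ} (hh : ∀ μ ν, 0 ≤ h μ ν) :
    ∑ π : T4AveragingDeficitWall.Plane d, (h π.1.1 π.1.2 + h π.1.2 π.1.1) ≤ 2 * ∑ μ : Fin d, ∑ ν : Fin d, h μ ν := by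
  classical
  have hE : ∑ π : T4AveragingDeficitWall.Plane d, (h π.1.1 π.1.2 + h π.1.2 π.1.1)
      = ∑ a ∈ (Finset.univ : Finset (Fin d × Fin d)).filter (fun a => a.1 < a.2), (h a.1 a.2 + h a.2 a.1) :=
    (Finset.sum_subtype ((Finset.univ : Finset (Fin d × Fin d)).filter (fun a => a.1 < a.2)) (by simp)
      (fun a : Fin d × Fin d => h a.1 a.2 + h a.2 a.1)).symm
  have hall : ∑ a : Fin d × Fin d, h a.1 a.2 = ∑ μ : Fin d, ∑ ν : Fin d, h μ ν := by rw [← Finset.univ_product_univ, Finset.sum_product]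
  have hall' : ∑ a : Fin d × Fin d, h a.2 a.1 = ∑ μ : Fin d, ∑ ν : Fin d, h μ ν := by
    rw [← hall, ← Equiv.sum_comp (Equiv.prodComm (Fin d) (Fin d)) (fun a : Fin d × Fin d => h a.1 a.2)]
    rfl
  rw [hE, Finset.sum_add_distrib, two_mul]
  exact add_le_add
    ((Finset.sum_le_sum_of_subset_of_nonneg (Finset.filter_subset _ _) fun a _ _ => hh a.1 a.2).trans (le_of_eq hall))
    ((Finset.sum_le_sum_of_subset_of_nonneg (Finset.filter_subset _ _) fun a _ _ => hh a.2 a.1).trans (le_of_eq hall'))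

omit [Fintype n] [DecidableEq n] in
/-- Corner shifts of a periodic density: `Σ_{z ∈ periodBox N} Σ_{T ⊆ univ} g (z + 𝟙_T) = 2^d·Σ_{z ∈ periodBox N} g z` (`N ≥ 1`, `g` `N`-periodic). [folklore] -/
theorem sum_periodBox_sum_indic {N : ℕ} (hN : 1 ≤ N) {g : Site d → ℝ} (hg : ∀ (x : Site d) (κ : Fin d), g (x + (N : ℤ) • e κ) = g x) :
    ∑ z ∈ periodBox (d := d) N, ∑ T ∈ (Finset.univ : Finset (Fin d)).powerset, g (z + indic T) = 2 ^ d * ∑ z ∈ periodBox (d := d) N, g z := by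
  rw [Finset.sum_comm, Finset.sum_congr rfl fun T _ => sum_periodBox_shift N hN hg (indic T), Finset.sum_const, Finset.card_powerset, Finset.card_univ,
    Fintype.card_fin, nsmul_eq_mul, Nat.cast_pow, Nat.cast_two]

/-- **THE HOMOGENEOUS CURL LETTER OF THE INTERPOLATION LIFT** (`M ≥ 2`, `N ≥ 1`, `φ` `N`-periodic):
`Σ_{p ∈ perWin (M·N)} nhsNormSq (curl_1 (ilift M φ) p) ≤ 2304·4^d·(M^d∕M⁴)·Σ_{z ∈ periodBox N} Σ_μ Σ_ν nhsNormSq (φ (z + e_μ) ν − φ z ν)` — bounded by the coarse GRADIENT energy;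
`M^{d−4} = 1` at `d = 4`. [folklore] -/
theorem sum_nhsNormSq_curl_interpLift_le [Nonempty n] {M : ℕ} (hM : 2 ≤ M) {N : ℕ} (hN : 1 ≤ N) {φ : Site d → Fin d → Matrix n n ℂ}
    (hφ : ∀ (z : Site d) (τ κ : Fin d), φ (z + (N : ℤ) • e τ) κ = φ z κ) :
    ∑ p ∈ perWin d (M * N), nhsNormSq (curl (BlockAveragePushDirSplit.flat (d := d) (n := n))
        (fun z κ' => ((12 * (M : ℝ) / ((((M : ℝ)) - 1) * ((M : ℝ) + 1) * ((M : ℝ) + 2))) * lprof M (res M z κ'))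
          • interp M (Finset.univ.erase κ') (fun w => φ w κ') z) p)
      ≤ 2304 * 4 ^ d * ((M : ℝ) ^ d / (M : ℝ) ^ 4) * ∑ z ∈ periodBox (d := d) N, ∑ μ : Fin d, ∑ ν : Fin d, nhsNormSq (φ (z + e μ) ν - φ z ν) := by
  have hM1 : 1 ≤ M := by omega
  have hM0 : (0 : ℝ) < M := by exact_mod_cast (by omega : 0 < M)
  set C : ℝ := (24 / (M : ℝ) ^ 2) ^ 2 * 2 ^ d with hC
  -- the corner-summed gradient density of a coarse site
  set F : Fin d → Fin d → Site d → ℝ := fun μ ν z => ∑ T ∈ (Finset.univ : Finset (Fin d)).powerset, nhsNormSq (φ (z + indic T + e μ) ν - φ (z + indic T) ν) with hF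
  have hF0 : ∀ μ ν z, 0 ≤ F μ ν z := fun μ ν z => Finset.sum_nonneg fun T _ => nhsNormSq_nonneg _
  -- one site: sum over planes
  have hsite : ∀ x : Site d, ∑ π : T4AveragingDeficitWall.Plane d, nhsNormSq (curlAt (BlockAveragePushDirSplit.flat (d := d) (n := n))
      (fun z κ' => ((12 * (M : ℝ) / ((((M : ℝ)) - 1) * ((M : ℝ) + 1) * ((M : ℝ) + 2))) * lprof M (res M z κ'))
        • interp M (Finset.univ.erase κ') (fun w => φ w κ') z) x π.1.1 π.1.2)
      ≤ 2 * C * (2 * ∑ μ : Fin d, ∑ ν : Fin d, F μ ν (blk M x)) := by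
    intro x
    calc _ ≤ ∑ π : T4AveragingDeficitWall.Plane d, 2 * C * (F π.1.1 π.1.2 (blk M x) + F π.1.2 π.1.1 (blk M x)) :=
          Finset.sum_le_sum fun π _ => by
            have h := nhsNormSq_curlAt_flat_interpLift_le hM φ x (ne_of_lt π.2)
            rw [hC]; simp only [hF]; linarith
      _ = 2 * C * ∑ π : T4AveragingDeficitWall.Plane d, (F π.1.1 π.1.2 (blk M x) + F π.1.2 π.1.1 (blk M x)) := by rw [Finset.mul_sum]
      _ ≤ 2 * C * (2 * ∑ μ : Fin d, ∑ ν : Fin d, F μ ν (blk M x)) :=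
          mul_le_mul_of_nonneg_left (sum_plane_le_sum_all (h := fun μ ν => F μ ν (blk M x)) fun μ ν => hF0 μ ν _) (by positivity)
  -- the corner shifts of the periodic gradient density
  have hper : ∀ (x : Site d) (κ : Fin d), (∑ μ : Fin d, ∑ ν : Fin d, nhsNormSq (φ (x + (N : ℤ) • e κ + e μ) ν - φ (x + (N : ℤ) • e κ) ν))
      = ∑ μ : Fin d, ∑ ν : Fin d, nhsNormSq (φ (x + e μ) ν - φ x ν) := by
    intro x κ
    refine Finset.sum_congr rfl fun μ _ => Finset.sum_congr rfl fun ν _ => ?_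
    rw [add_right_comm, hφ, hφ]
  have hcorner : ∑ z ∈ periodBox (d := d) N, ∑ μ : Fin d, ∑ ν : Fin d, F μ ν z
      = 2 ^ d * ∑ z ∈ periodBox (d := d) N, ∑ μ : Fin d, ∑ ν : Fin d, nhsNormSq (φ (z + e μ) ν - φ z ν) := by
    rw [← sum_periodBox_sum_indic hN (g := fun z => ∑ μ : Fin d, ∑ ν : Fin d, nhsNormSq (φ (z + e μ) ν - φ z ν)) hper]
    refine Finset.sum_congr rfl fun z _ => ?_
    simp only [hF]
    symm
    rw [Finset.sum_comm (s := (Finset.univ : Finset (Fin d)).powerset) (t := (Finset.univ : Finset (Fin d)))]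
    refine Finset.sum_congr rfl fun μ _ => ?_
    exact Finset.sum_comm (s := (Finset.univ : Finset (Fin d)).powerset) (t := (Finset.univ : Finset (Fin d)))
  rw [sum_perWin_nhsNormSq_curl']
  calc _ ≤ ∑ x ∈ periodBox (d := d) (M * N), 2 * C * (2 * ∑ μ : Fin d, ∑ ν : Fin d, F μ ν (blk M x)) := Finset.sum_le_sum fun x _ => hsite x
    _ = (M : ℝ) ^ d * ∑ z ∈ periodBox (d := d) N, 2 * C * (2 * ∑ μ : Fin d, ∑ ν : Fin d, F μ ν z) := by
        rw [← sum_periodBox_blocks M N hM1, Finset.mul_sum]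
        refine Finset.sum_congr rfl fun z _ => ?_
        rw [Finset.sum_congr rfl fun v hv => by rw [blk_block hM1 z hv], Finset.sum_const, card_periodBox, nsmul_eq_mul, Nat.cast_pow]
    _ = (M : ℝ) ^ d * (4 * C) * ∑ z ∈ periodBox (d := d) N, ∑ μ : Fin d, ∑ ν : Fin d, F μ ν z := by
        rw [← Finset.mul_sum, ← Finset.mul_sum]; ring
    _ = 2304 * 4 ^ d * ((M : ℝ) ^ d / (M : ℝ) ^ 4) * ∑ z ∈ periodBox (d := d) N, ∑ μ : Fin d, ∑ ν : Fin d, nhsNormSq (φ (z + e μ) ν - φ z ν) := by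
        rw [hcorner, hC]
        have h4 : (4 : ℝ) ^ d = 2 ^ d * 2 ^ d := by rw [← mul_pow]; norm_num
        rw [h4]
        field_simp
        ring

end

end Summit.QuantumFields.BalabanUV.T4Continuum.NE7InterpolationLiftCurl
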